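import Literature.Computability.AlgebraicComplexity.MatrixMultiplicationExponent
import Mathlib.LinearAlgebra.FiniteDimensional.Lemmas
import Mathlib.LinearAlgebra.Matrix.NonsingularInverse
import Mathlib.LinearAlgebra.FreeModule.Finite.Basic
import HarnessLib

/-!
# `7 ≤ R(⟨2,2,2⟩)` over every field (Winograd 1971; Hopcroft–Kerr 1971) — proof

Main result `seven_le_tensorRank_matMulTensor_two`: over every field `K`, the matrix
multiplication tensor `⟨2,2,2⟩` (`matMulTensor K 2 2 2` of `MatrixMultiplicationExponent.lean`)
has `tensorRank ≥ 7` [Winograd1971, Thm. 3.1] ("Every algorithm for multiplying two `2 × 2`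
matrices requires at least seven multiplications"); together with Strassen's algorithm,
`R(⟨2,2,2⟩) = 7`. It is the body of the discharge of the named fact
`winograd1971_seven_le_tensorRank_matMulTensor_two` of `SmallFormatRank.lean` (whose `_holds`
theorem is the one-line application of `seven_le_tensorRank_matMulTensor_two`).

## The proof followed

Winograd's own argument (LAA 4 (1971), §3) is written over `ℚ` in the model with commutativity.
For the rank statement over an ARBITRARY field we follow the proof printed in
Bürgisser–Clausen–Shokrollahi, *Algebraic Complexity Theory* (1997), Prop. (17.9) (proof credited
to Baur: "If `A` is a simple `k`-algebra then `R(A) ≥ 2 dim A − 1`", `k` any field) and its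
Cor. (17.10) "(Hopcroft and Kerr, Winograd). The rank of `k^{2×2}` is equal to `7`", specialised
to `A = k^{2×2}` (`dim A = 4`, minimal left ideals of dimension `2`, maximal left ideals
`{u pᵀ : u ∈ k²}`):

* a triad decomposition of `⟨2,2,2⟩` of length `r` is a bilinear computation
  `X Y = ∑ᵢ fᵢ(X) gᵢ(Y) Wᵢ` (`mul_eq_sum_of_decomposition`);
* (Baur, step 1) the `fᵢ` separate points; pick three of them with dual vectors;
* (step 2) a common zero `b ≠ 0` of the other `≤ 3` forms `gᵢ` gives
  `A b ⊆ ⟨W_{i₁}, W_{i₂}, W_{i₃}⟩`,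
  so `b` is singular, `b = q pᵀ`, `A b = L := {u pᵀ}` a maximal left ideal, and some `W_j ∈ L`
  with `g_j(b) ≠ 0`;
* (step 3) the `gᵢ`, `i ≠ j`, separate points, so two of them restrict to a basis of `L*`;
  a common zero `a ≠ 0` of the remaining `≤ 3` forms `fᵢ` then satisfies `a A ⊆ L`, impossible
  for `a ≠ 0` (Fact (17.8)(4): no non-zero right ideal inside a proper left ideal).

Everything is elementary linear algebra over `Matrix (Fin 2) (Fin 2) K`; no new definitions of
mathematical content, no new named facts.
-/

namespace Literature.Computability.AlgebraicComplexity

open scoped BigOperators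
open Matrix

namespace TwoByTwoRank

variable {K : Type*} [Field K]

/-! ### From a triad decomposition to a bilinear computation -/

/-- Rearranging a sum of products of two linear forms (pure algebra). [folklore] -/
theorem sum_form_mul_form {ι : Type*} [Fintype ι] (w u v : ι → Fin 2 × Fin 2 → K)
    (a : Fin 2 × Fin 2) (X Y : Matrix (Fin 2) (Fin 2) K) :
    ∑ i, (∑ b, u i b * X b.1 b.2) * (∑ c, v i c * Y c.1 c.2) * w i a =
      ∑ b, ∑ c, (∑ i, w i a * u i b * v i c) * (X b.1 b.2 * Y c.1 c.2) := by
  have step : ∀ i, (∑ b, u i b * X b.1 b.2) * (∑ c, v i c * Y c.1 c.2) * w i a =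
      ∑ b, ∑ c, w i a * u i b * v i c * (X b.1 b.2 * Y c.1 c.2) := by
    intro i
    rw [Finset.sum_mul_sum, Finset.sum_mul]
    refine Finset.sum_congr rfl fun b _ => ?_
    rw [Finset.sum_mul]
    refine Finset.sum_congr rfl fun c _ => ?_
    ring
  simp only [step]
  rw [Finset.sum_comm]
  refine Finset.sum_congr rfl fun b _ => ?_
  rw [Finset.sum_comm]
  refine Finset.sum_congr rfl fun c _ => ?_
  rw [Finset.sum_mul]

/-- **A triad decomposition of `⟨2,2,2⟩` is a bilinear computation of the `2 × 2` matrix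
product**: if `⟨2,2,2⟩ = ∑ᵢ wᵢ ⊗ uᵢ ⊗ vᵢ` then `X Y = ∑ᵢ uᵢ(X) vᵢ(Y) Wᵢ` for all `X, Y`, with the
linear forms `uᵢ(X) = ∑_b uᵢ(b) X_b`, `vᵢ(Y) = ∑_c vᵢ(c) Y_c` and the matrices
`Wᵢ = (wᵢ(r,s))_{r,s}`
(BCS 1997, §14.1: rank = length of an optimal bilinear computation).
[cite: BurgisserClausenShokrollahi1997, Sect. 14.1] -/
theorem mul_eq_sum_of_decomposition {ι : Type*} [Fintype ι] (w u v : ι → Fin 2 × Fin 2 → K)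
    (h : matMulTensor K 2 2 2 = ∑ i, triad (w i) (u i) (v i)) (X Y : Matrix (Fin 2) (Fin 2) K) :
    X * Y = ∑ i, ((∑ b, u i b * X b.1 b.2) * (∑ c, v i c * Y c.1 c.2)) •
      Matrix.of (fun r s => w i (r, s)) := by
  ext r s
  have key : ∀ b c : Fin 2 × Fin 2,
      ∑ i, w i (r, s) * u i b * v i c = matMulTensor K 2 2 2 (r, s) b c := by
    intro b c
    rw [h, Finset.sum_apply, Finset.sum_apply, Finset.sum_apply]
    simp only [triad_apply]
  rw [Matrix.sum_apply]
  simp only [Matrix.smul_apply, Matrix.of_apply, smul_eq_mul]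
  rw [sum_form_mul_form]
  simp only [key]
  fin_cases r <;> fin_cases s <;>
    simp [matMulTensor, Fintype.sum_prod_type, Fin.sum_univ_two, Matrix.mul_apply]

/-! ### Linear algebra on `2 × 2` matrices -/

/-- `dim_K K^{2×2} = 4`. [folklore] -/
theorem finrank_mat_two : Module.finrank K (Matrix (Fin 2) (Fin 2) K) = 4 := by
  simp [Module.finrank_matrix]

/-- Common zeros: the linear forms indexed by the complement of a finset `s` with
`|ι| ≤ |s| + 3` (so at most three forms) have a common non-zero zero on the `4`-dimensional
space `K^{2×2}`. [folklore] -/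
theorem exists_ne_zero_forall_not_mem {ι : Type*} [Fintype ι] [DecidableEq ι]
    (φ : ι → (Matrix (Fin 2) (Fin 2) K →ₗ[K] K)) (s : Finset ι) (hs : Fintype.card ι ≤ s.card + 3) :
    ∃ x : Matrix (Fin 2) (Fin 2) K, x ≠ 0 ∧ ∀ i, i ∉ s → φ i x = 0 := by
  let F : Matrix (Fin 2) (Fin 2) K →ₗ[K] ({i // i ∉ s} → K) := LinearMap.pi fun t => φ t.1
  have hlt : Module.finrank K ({i // i ∉ s} → K) < Module.finrank K (Matrix (Fin 2) (Fin 2) K) := by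
    rw [Module.finrank_fintype_fun_eq_card, finrank_mat_two, Fintype.card_subtype_compl,
      Fintype.card_coe]
    omega
  obtain ⟨x, hx, hx0⟩ := (Submodule.ne_bot_iff _).mp
    (LinearMap.ker_ne_bot_of_finrank_lt (f := F) hlt)
  refine ⟨x, hx0, fun i hi => ?_⟩
  have hx' := congrFun (LinearMap.mem_ker.mp hx) ⟨i, hi⟩
  simpa [F] using hx'

/-- A single linear form on `K^{2×2}` has a non-zero zero. [folklore] -/
theorem exists_ne_zero_eq_zero₁ (φ : Matrix (Fin 2) (Fin 2) K →ₗ[K] K) :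
    ∃ x : Matrix (Fin 2) (Fin 2) K, x ≠ 0 ∧ φ x = 0 := by
  have hlt : Module.finrank K K < Module.finrank K (Matrix (Fin 2) (Fin 2) K) := by
    rw [finrank_mat_two, Module.finrank_self]; norm_num
  obtain ⟨x, hx, hx0⟩ := (Submodule.ne_bot_iff _).mp
    (LinearMap.ker_ne_bot_of_finrank_lt (f := φ) hlt)
  exact ⟨x, hx0, LinearMap.mem_ker.mp hx⟩

/-- Two linear forms on `K^{2×2}` have a common non-zero zero. [folklore] -/
theorem exists_ne_zero_eq_zero₂ (φ ψ : Matrix (Fin 2) (Fin 2) K →ₗ[K] K) :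
    ∃ x : Matrix (Fin 2) (Fin 2) K, x ≠ 0 ∧ φ x = 0 ∧ ψ x = 0 := by
  have hlt : Module.finrank K (K × K) < Module.finrank K (Matrix (Fin 2) (Fin 2) K) := by
    rw [finrank_mat_two, Module.finrank_prod, Module.finrank_self]
    norm_num
  obtain ⟨x, hx, hx0⟩ := (Submodule.ne_bot_iff _).mp
    (LinearMap.ker_ne_bot_of_finrank_lt (f := φ.prod ψ) hlt)
  rw [LinearMap.mem_ker, LinearMap.prod_apply, Prod.mk_eq_zero] at hx
  exact ⟨x, hx0, hx.1, hx.2⟩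

/-- A linear form on `K²` has a non-zero zero. [folklore] -/
theorem exists_ne_zero_eq_zero_fin_two (φ : (Fin 2 → K) →ₗ[K] K) :
    ∃ u : Fin 2 → K, u ≠ 0 ∧ φ u = 0 := by
  have hlt : Module.finrank K K < Module.finrank K (Fin 2 → K) := by simp
  obtain ⟨x, hx, hx0⟩ := (Submodule.ne_bot_iff _).mp
    (LinearMap.ker_ne_bot_of_finrank_lt (f := φ) hlt)
  exact ⟨x, hx0, LinearMap.mem_ker.mp hx⟩

/-- For `v ≠ 0` in `K²`, `X ↦ X v` maps `K^{2×2}` onto `K²`. [folklore] -/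
theorem exists_mulVec_eq (v : Fin 2 → K) (hv : v ≠ 0) (t : Fin 2 → K) :
    ∃ X : Matrix (Fin 2) (Fin 2) K, X *ᵥ v = t := by
  obtain ⟨l, hl⟩ : ∃ l, v l ≠ 0 := by
    by_contra h
    push Not at h
    exact hv (funext h)
  refine ⟨Matrix.of fun i j => if j = l then t i / v l else 0, ?_⟩
  ext i
  simp [Matrix.mulVec, dotProduct, hl]

/-- A non-zero matrix moves some vector. [folklore] -/
theorem exists_mulVec_ne_zero (y : Matrix (Fin 2) (Fin 2) K) (hy : y ≠ 0) :
    ∃ z : Fin 2 → K, y *ᵥ z ≠ 0 := by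
  by_contra h
  push Not at h
  apply hy
  ext i j
  have hij := congrFun (h (Pi.single j 1)) i
  simpa [Matrix.mulVec_single_one] using hij

/-- If `u pᵀ = 0` and `p ≠ 0` then `u = 0`. [folklore] -/
theorem eq_zero_of_vecMulVec_eq_zero {u p : Fin 2 → K} (h : vecMulVec u p = 0) (hp : p ≠ 0) :
    u = 0 := by
  obtain ⟨t, ht⟩ : ∃ t, p t ≠ 0 := by
    by_contra h'
    push Not at h'
    exact hp (funext h')
  funext s
  have hst := congrFun (congrFun h s) t
  simp only [vecMulVec_apply, Matrix.zero_apply, mul_eq_zero] at hst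
  exact hst.resolve_right ht

/-- The two standard basis vectors of `K²` are not both multiples of one vector. [folklore] -/
theorem false_of_single_eq_smul (m : Fin 2 → K) (c₀ c₁ : K)
    (h₀ : (Pi.single 0 1 : Fin 2 → K) = c₀ • m) (h₁ : (Pi.single 1 1 : Fin 2 → K) = c₁ • m) :
    False := by
  have e00 := congrFun h₀ 0
  have e10 := congrFun h₁ 0
  have e11 := congrFun h₁ 1
  simp only [Pi.single_apply, Pi.smul_apply, smul_eq_mul] at e00 e10 e11
  simp only [if_true] at e00 e11
  have h10 : (1 : Fin 2) ≠ 0 := by decide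
  simp only [if_neg h10.symm] at e10
  rcases (zero_eq_mul.mp e10) with h | h
  · rw [h, zero_mul] at e11
    exact one_ne_zero e11
  · rw [h, mul_zero] at e00
    exact one_ne_zero e00

/-- A non-zero singular `2 × 2` matrix is an outer product `q pᵀ` with `p, q ≠ 0`. [folklore] -/
theorem exists_eq_vecMulVec (b : Matrix (Fin 2) (Fin 2) K) (hb : b ≠ 0) (hdet : b.det = 0) :
    ∃ p q : Fin 2 → K, p ≠ 0 ∧ q ≠ 0 ∧ b = vecMulVec q p := by
  rw [Matrix.det_fin_two, sub_eq_zero] at hdet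
  by_cases h00 : b 0 0 = 0
  · by_cases h01 : b 0 1 = 0
    · refine ⟨![b 1 0, b 1 1], ![0, 1], ?_, ?_, ?_⟩
      · intro hp
        apply hb
        ext i j
        fin_cases i <;> fin_cases j
        · simpa using h00
        · simpa using h01
        · simpa using congrFun hp 0
        · simpa using congrFun hp 1
      · intro hq
        simpa using congrFun hq 1
      · ext i j
        fin_cases i <;> fin_cases j <;> simp [vecMulVec_apply, h00, h01]
    · have h10 : b 1 0 = 0 := by
        rw [h00, zero_mul] at hdet
        exact (mul_eq_zero.mp hdet.symm).resolve_left h01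
      refine ⟨![0, b 0 1], ![1, b 1 1 / b 0 1], ?_, ?_, ?_⟩
      · intro hp
        exact h01 (by simpa using congrFun hp 1)
      · intro hq
        simpa using congrFun hq 0
      · ext i j
        fin_cases i <;> fin_cases j <;> simp [vecMulVec_apply, h00, h10, h01]
  · refine ⟨![b 0 0, b 0 1], ![1, b 1 0 / b 0 0], ?_, ?_, ?_⟩
    · intro hp
      exact h00 (by simpa using congrFun hp 0)
    · intro hq
      simpa using congrFun hq 0
    · have h11 : b 1 1 = b 1 0 / b 0 0 * b 0 1 := by
        field_simp
        linear_combination hdet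
      ext i j
      fin_cases i <;> fin_cases j <;> simp [vecMulVec_apply, h00]
      exact h11

/-- From linear forms on `K²` indexed by `l ≠ j` that separate points, two of them, `k₁ ≠ k₂`,
map `K²` jointly ONTO `K²` (they restrict to a basis of the dual; BCS 1997, Rem. (17.3)).
[cite: BurgisserClausenShokrollahi1997, Rem. (17.3)] -/
theorem exists_two_onto {ι : Type*} (h : ι → ((Fin 2 → K) →ₗ[K] K)) (j : ι)
    (hsep : ∀ u, (∀ l, l ≠ j → h l u = 0) → u = 0) :
    ∃ k₁ k₂, k₁ ≠ j ∧ k₂ ≠ j ∧ k₁ ≠ k₂ ∧ ∀ s t : K, ∃ u, h k₁ u = s ∧ h k₂ u = t := by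
  have hu₁ : (Pi.single 0 1 : Fin 2 → K) ≠ 0 := by
    intro h0
    simpa using congrFun h0 0
  obtain ⟨k₁, hk₁j, hk₁⟩ : ∃ k₁, k₁ ≠ j ∧ h k₁ (Pi.single 0 1) ≠ 0 := by
    by_contra hc
    push Not at hc
    exact hu₁ (hsep _ hc)
  obtain ⟨u₀, hu₀, hk₁u₀⟩ := exists_ne_zero_eq_zero_fin_two (h k₁)
  obtain ⟨k₂, hk₂j, hk₂⟩ : ∃ k₂, k₂ ≠ j ∧ h k₂ u₀ ≠ 0 := by
    by_contra hc
    push Not at hc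
    exact hu₀ (hsep _ hc)
  have hk₁₂ : k₁ ≠ k₂ := by
    rintro rfl
    exact hk₂ hk₁u₀
  refine ⟨k₁, k₂, hk₁j, hk₂j, hk₁₂, fun s t => ?_⟩
  refine ⟨(s / h k₁ (Pi.single 0 1)) • Pi.single 0 1 +
    ((t - s / h k₁ (Pi.single 0 1) * h k₂ (Pi.single 0 1)) / h k₂ u₀) • u₀, ?_, ?_⟩
  · simp only [map_add, map_smul, smul_eq_mul, hk₁u₀, mul_zero, add_zero]
    field_simp
  · simp only [map_add, map_smul, smul_eq_mul]
    field_simp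
    ring

/-- (Baur's proof, step 1: "since `A` is concise, we may assume that `f₁, …, fₙ` form a basis of
`A*`" — here only three of them are needed.) From linear forms on `K^{2×2}` separating points:
three indices `i₁, i₂, i₃` with dual vectors `x₁, x₂, x₃` (`f_{i_a}(x_b) ≠ 0 ↔ a = b`).
[cite: BurgisserClausenShokrollahi1997, Prop. (17.9)] -/
theorem exists_three_dual {ι : Type*} (φ : ι → (Matrix (Fin 2) (Fin 2) K →ₗ[K] K))
    (hsep : ∀ x, (∀ i, φ i x = 0) → x = 0) :
    ∃ i₁ i₂ i₃ x₁ x₂ x₃,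
      (φ i₁ x₁ ≠ 0 ∧ φ i₂ x₁ = 0 ∧ φ i₃ x₁ = 0) ∧
      (φ i₁ x₂ = 0 ∧ φ i₂ x₂ ≠ 0 ∧ φ i₃ x₂ = 0) ∧
      (φ i₁ x₃ = 0 ∧ φ i₂ x₃ = 0 ∧ φ i₃ x₃ ≠ 0) := by
  obtain ⟨i₁, hi₁⟩ : ∃ i₁, φ i₁ 1 ≠ 0 := by
    by_contra hc
    push Not at hc
    exact one_ne_zero (hsep _ hc)
  obtain ⟨y₂, hy₂, hy₂₁⟩ := exists_ne_zero_eq_zero₁ (φ i₁)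
  obtain ⟨i₂, hi₂⟩ : ∃ i₂, φ i₂ y₂ ≠ 0 := by
    by_contra hc
    push Not at hc
    exact hy₂ (hsep _ hc)
  obtain ⟨y₃, hy₃, hy₃₁, hy₃₂⟩ := exists_ne_zero_eq_zero₂ (φ i₁) (φ i₂)
  obtain ⟨i₃, hi₃⟩ : ∃ i₃, φ i₃ y₃ ≠ 0 := by
    by_contra hc
    push Not at hc
    exact hy₃ (hsep _ hc)
  -- back-substitution: clean `y₂` against `φ i₃`, then `1` against `φ i₂`, `φ i₃`
  set x₂ : Matrix (Fin 2) (Fin 2) K := y₂ - (φ i₃ y₂ / φ i₃ y₃) • y₃ with hx₂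
  have hx₂₁ : φ i₁ x₂ = 0 := by
    simp only [hx₂, map_sub, map_smul, smul_eq_mul, hy₂₁, hy₃₁, mul_zero, sub_zero]
  have hx₂₂ : φ i₂ x₂ ≠ 0 := by
    simpa only [hx₂, map_sub, map_smul, smul_eq_mul, hy₃₂, mul_zero, sub_zero] using hi₂
  have hx₂₃ : φ i₃ x₂ = 0 := by
    simp only [hx₂, map_sub, map_smul, smul_eq_mul]
    field_simp
    ring
  set x₁ : Matrix (Fin 2) (Fin 2) K :=
    1 - (φ i₂ 1 / φ i₂ x₂) • x₂ - (φ i₃ 1 / φ i₃ y₃) • y₃ with hx₁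
  have hx₁₁ : φ i₁ x₁ ≠ 0 := by
    simpa only [hx₁, map_sub, map_smul, smul_eq_mul, hx₂₁, hy₃₁, mul_zero, sub_zero] using hi₁
  have hx₁₂ : φ i₂ x₁ = 0 := by
    simp only [hx₁, map_sub, map_smul, smul_eq_mul, hy₃₂, mul_zero, sub_zero]
    field_simp
    ring
  have hx₁₃ : φ i₃ x₁ = 0 := by
    simp only [hx₁, map_sub, map_smul, smul_eq_mul, hx₂₃, mul_zero, sub_zero]
    field_simp
    ring
  exact ⟨i₁, i₂, i₃, x₁, x₂, y₃, ⟨hx₁₁, hx₁₂, hx₁₃⟩, ⟨hx₂₁, hx₂₂, hx₂₃⟩, ⟨hy₃₁, hy₃₂, hi₃⟩⟩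

/-! ### Baur's argument for a bilinear computation of length `≤ 6` -/

/-- (Baur's proof, step 3, "the linear forms `g_m, …, g_r` generate `A*`".) In a bilinear
computation `X Y = ∑ᵢ fᵢ(X) gᵢ(Y) Wᵢ` of the `2 × 2` product, the forms `gᵢ`, `i ≠ j`, separate
points: a common zero `y` has `A y ⊆ K W_j`, while `dim A y = 2 · rank y`.
[cite: BurgisserClausenShokrollahi1997, Prop. (17.9)] -/
theorem eq_zero_of_forall_ne_apply_eq_zero {ι : Type*} [Fintype ι] [DecidableEq ι]
    (f g : ι → (Matrix (Fin 2) (Fin 2) K →ₗ[K] K)) (W : ι → Matrix (Fin 2) (Fin 2) K)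
    (hXY : ∀ X Y : Matrix (Fin 2) (Fin 2) K, X * Y = ∑ i, (f i X * g i Y) • W i)
    (j : ι) (y : Matrix (Fin 2) (Fin 2) K) (hy : ∀ l, l ≠ j → g l y = 0) : y = 0 := by
  by_contra hy0
  obtain ⟨z, hz⟩ := exists_mulVec_ne_zero y hy0
  have key : ∀ X : Matrix (Fin 2) (Fin 2) K, X *ᵥ (y *ᵥ z) = (f j X * g j y) • (W j *ᵥ z) := by
    intro X
    rw [Matrix.mulVec_mulVec, hXY X y, Finset.sum_eq_single j, Matrix.smul_mulVec]
    · intro l _ hl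
      rw [hy l hl, mul_zero, zero_smul]
    · intro hj
      exact absurd (Finset.mem_univ j) hj
  obtain ⟨X₀, hX₀⟩ := exists_mulVec_eq _ hz (Pi.single 0 1)
  obtain ⟨X₁, hX₁⟩ := exists_mulVec_eq _ hz (Pi.single 1 1)
  exact false_of_single_eq_smul (W j *ᵥ z) _ _ (hX₀.symm.trans (key X₀)) (hX₁.symm.trans (key X₁))

/-- **The core of Baur's proof of BCS Prop. (17.9) for `A = K^{2×2}`.** Data: a bilinear
computation of length `|ι| ≤ 6`; indices `j, i, i'`; `b ≠ 0` killed by all `g_l`,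
`l ∉ {j, i, i'}`, with `g_j(b) ≠ 0`; and `x` with `f_i(x) = f_{i'}(x) = 0 ≠ f_j(x)`.
Then: `A b ⊆ ⟨W_j, W_i, W_{i'}⟩` forces `det b = 0`, `b = q pᵀ`, `A b = L := {u pᵀ}` (a maximal
left ideal) and `W_j ∈ L`; the `g_l`, `l ≠ j`, separate points, two of them restrict to a basis
of `L*`; a common zero `a ≠ 0` of the other `≤ 3` forms `f_l` has `a A ⊆ L`, contradicting
Fact (17.8)(4). [cite: BurgisserClausenShokrollahi1997, Prop. (17.9)] -/
theorem false_of_computation_core {ι : Type*} [Fintype ι] [DecidableEq ι]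
    (hι : Fintype.card ι ≤ 6) (f g : ι → (Matrix (Fin 2) (Fin 2) K →ₗ[K] K))
    (W : ι → Matrix (Fin 2) (Fin 2) K)
    (hXY : ∀ X Y : Matrix (Fin 2) (Fin 2) K, X * Y = ∑ i, (f i X * g i Y) • W i)
    (j i i' : ι) (x b : Matrix (Fin 2) (Fin 2) K) (hb : b ≠ 0)
    (hg : ∀ l, l ≠ j → l ≠ i → l ≠ i' → g l b = 0)
    (hgj : g j b ≠ 0) (hfj : f j x ≠ 0) (hfi : f i x = 0) (hfi' : f i' x = 0) :
    False := by
  -- C1: `x b = (f_j x · g_j b) W_j`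
  have hxb : x * b = (f j x * g j b) • W j := by
    rw [hXY x b, Finset.sum_eq_single j]
    · intro l _ hl
      by_cases hli : l = i
      · subst hli; rw [hfi, zero_mul, zero_smul]
      by_cases hli' : l = i'
      · subst hli'; rw [hfi', zero_mul, zero_smul]
      rw [hg l hl hli hli', mul_zero, zero_smul]
    · intro hj
      exact absurd (Finset.mem_univ j) hj
  -- C2: `det b = 0`, since `A b ⊆ ⟨W_j, W_i, W_i'⟩` has dimension `≤ 3 < 4`
  have hspan : ∀ X : Matrix (Fin 2) (Fin 2) K,
      X * b ∈ Submodule.span K (Set.range ![W j, W i, W i']) := by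
    intro X
    rw [hXY X b]
    refine Submodule.sum_mem _ fun l _ => ?_
    by_cases hl : l = j ∨ l = i ∨ l = i'
    · refine Submodule.smul_mem _ _ (Submodule.subset_span ?_)
      rcases hl with rfl | rfl | rfl
      · exact ⟨0, rfl⟩
      · exact ⟨1, rfl⟩
      · exact ⟨2, rfl⟩
    · push Not at hl
      rw [hg l hl.1 hl.2.1 hl.2.2, mul_zero, zero_smul]
      exact Submodule.zero_mem _
  have hdet : b.det = 0 := by
    by_contra hdet
    have hunit : IsUnit b.det := isUnit_iff_ne_zero.mpr hdet
    have htop :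
        (⊤ : Submodule K (Matrix (Fin 2) (Fin 2) K)) ≤
          Submodule.span K (Set.range ![W j, W i, W i']) := by
      intro Y _
      have hY := hspan (Y * b⁻¹)
      rwa [Matrix.nonsing_inv_mul_cancel_right _ _ hunit] at hY
    have h4 : Module.finrank K (Matrix (Fin 2) (Fin 2) K) ≤ 3 := by
      calc Module.finrank K (Matrix (Fin 2) (Fin 2) K)
          = Module.finrank K (⊤ : Submodule K (Matrix (Fin 2) (Fin 2) K)) := (finrank_top K _).symm
        _ ≤ Module.finrank K (Submodule.span K (Set.range ![W j, W i, W i'])) :=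
          Submodule.finrank_mono htop
        _ ≤ Fintype.card (Fin 3) := finrank_range_le_card _
        _ = 3 := Fintype.card_fin 3
    rw [finrank_mat_two] at h4
    omega
  -- C3: `b = q pᵀ`
  obtain ⟨p, q, hp, hq, rfl⟩ := exists_eq_vecMulVec b hb hdet
  -- C4: the maximal left ideal `L = {u pᵀ}` ⊇ `A b`, and `W_j ∈ L`
  let outer : (Fin 2 → K) →ₗ[K] Matrix (Fin 2) (Fin 2) K :=
    { toFun := fun u => vecMulVec u p
      map_add' := fun u u' => by
        ext r c
        simp [vecMulVec_apply, add_mul]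
      map_smul' := fun c u => by
        ext r s
        simp [vecMulVec_apply, mul_assoc] }
  have outer_apply : ∀ u, outer u = vecMulVec u p := fun u => rfl
  let L : Submodule K (Matrix (Fin 2) (Fin 2) K) := LinearMap.range outer
  have hmulL : ∀ (X : Matrix (Fin 2) (Fin 2) K) (u : Fin 2 → K), X * vecMulVec u p ∈ L := fun X u =>
    ⟨X *ᵥ u, by rw [outer_apply, Matrix.mul_vecMulVec]⟩
  have hWjL : W j ∈ L := by
    have hc : f j x * g j (vecMulVec q p) ≠ 0 := mul_ne_zero hfj hgj
    have : W j = (f j x * g j (vecMulVec q p))⁻¹ • (x * vecMulVec q p) := by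
      rw [hxb, inv_smul_smul₀ hc]
    rw [this]
    exact Submodule.smul_mem _ _ (hmulL x q)
  -- C5: the `g_l`, `l ≠ j`, separate the points of `A`, hence of `L ≅ K²`
  have hsep : ∀ u : Fin 2 → K, (∀ l, l ≠ j → (g l).comp outer u = 0) → u = 0 := by
    intro u hu
    have h0 : vecMulVec u p = 0 :=
      eq_zero_of_forall_ne_apply_eq_zero f g W hXY j _ fun l hl => by
        simpa [outer_apply] using hu l hl
    exact eq_zero_of_vecMulVec_eq_zero h0 hp
  -- C6: two of them, `g_{k₁}, g_{k₂}`, restrict to a basis of `L*`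
  obtain ⟨k₁, k₂, hk₁j, hk₂j, hk₁₂, honto⟩ := exists_two_onto (fun l => (g l).comp outer) j hsep
  -- C7: a common zero `a ≠ 0` of the `f_l`, `l ∉ {j, k₁, k₂}`
  have hcard : ({j, k₁, k₂} : Finset ι).card = 3 := by
    rw [Finset.card_eq_three]
    exact ⟨j, k₁, k₂, hk₁j.symm, hk₂j.symm, hk₁₂, rfl⟩
  obtain ⟨a, ha, hfa⟩ := exists_ne_zero_forall_not_mem f {j, k₁, k₂} (by omega)
  -- C8: `a A ⊆ L`
  have haL : ∀ y : Matrix (Fin 2) (Fin 2) K, a * y ∈ L := by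
    intro y
    obtain ⟨u, hu₁, hu₂⟩ := honto (g k₁ y) (g k₂ y)
    simp only [LinearMap.comp_apply, outer_apply] at hu₁ hu₂
    have hsplit : a * y = a * (y - vecMulVec u p) + a * vecMulVec u p := by
      rw [mul_sub, sub_add_cancel]
    rw [hsplit]
    refine Submodule.add_mem _ ?_ (hmulL a u)
    rw [hXY, Finset.sum_eq_single j]
    · exact Submodule.smul_mem _ _ hWjL
    · intro l _ hl
      by_cases hl₁ : l = k₁
      · subst hl₁; rw [map_sub, hu₁, sub_self, mul_zero, zero_smul]
      by_cases hl₂ : l = k₂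
      · subst hl₂; rw [map_sub, hu₂, sub_self, mul_zero, zero_smul]
      have hl' : l ∉ ({j, k₁, k₂} : Finset ι) := by simp [hl, hl₁, hl₂]
      rw [hfa l hl', zero_mul, zero_smul]
    · intro hj
      exact absurd (Finset.mem_univ j) hj
  -- C9: `a A ⊆ L` forces `a = 0` (no non-zero right ideal inside a proper left ideal)
  set z : Fin 2 → K := ![p 1, -p 0] with hz
  have hz0 : z ≠ 0 := by
    intro h0
    apply hp
    have h0' := congrFun h0 0
    have h1' := congrFun h0 1
    simp only [hz, Matrix.cons_val_zero, Matrix.cons_val_one, Pi.zero_apply, neg_eq_zero] at h0' h1'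
    funext t
    fin_cases t
    · exact h1'
    · exact h0'
  have hpz : p ⬝ᵥ z = 0 := by
    simp [hz, dotProduct, Fin.sum_univ_two]
    ring
  have hLz : ∀ m ∈ L, m *ᵥ z = 0 := by
    rintro m ⟨u, rfl⟩
    rw [outer_apply, Matrix.vecMulVec_mulVec, hpz]
    simp
  have hayz : ∀ y : Matrix (Fin 2) (Fin 2) K, a *ᵥ (y *ᵥ z) = 0 := fun y => by
    rw [Matrix.mulVec_mulVec]
    exact hLz _ (haL y)
  apply ha
  ext r c
  obtain ⟨y, hy⟩ := exists_mulVec_eq z hz0 (Pi.single c 1)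
  have h := hayz y
  rw [hy, Matrix.mulVec_single_one] at h
  simpa using congrFun h r

/-- **No bilinear computation of length `≤ 6` for the `2 × 2` matrix product** (BCS 1997,
Prop. (17.9) with `A = K^{2×2}`, `2 dim A − 1 = 7`; proof after Baur): steps 1–2 of the proof
choose the three dual forms, the common zero `b` of the other `gᵢ`, and the index `j` with
`g_j(b) W_j ≠ 0`, then `false_of_computation_core` concludes.
[cite: BurgisserClausenShokrollahi1997, Prop. (17.9)] -/
theorem false_of_computation {ι : Type*} [Fintype ι] [DecidableEq ι]
    (hι : Fintype.card ι ≤ 6) (f g : ι → (Matrix (Fin 2) (Fin 2) K →ₗ[K] K))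
    (W : ι → Matrix (Fin 2) (Fin 2) K)
    (hXY : ∀ X Y : Matrix (Fin 2) (Fin 2) K, X * Y = ∑ i, (f i X * g i Y) • W i) : False := by
  -- step 1: the `fᵢ` separate points (`x = x · 1`)
  have hsepf : ∀ x : Matrix (Fin 2) (Fin 2) K, (∀ i, f i x = 0) → x = 0 := by
    intro x hx
    rw [← mul_one x, hXY]
    exact Finset.sum_eq_zero fun i _ => by rw [hx i, zero_mul, zero_smul]
  obtain ⟨i₁, i₂, i₃, x₁, x₂, x₃, ⟨h₁₁, h₂₁, h₃₁⟩, ⟨h₁₂, h₂₂, h₃₂⟩, ⟨h₁₃, h₂₃, h₃₃⟩⟩ :=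
    exists_three_dual f hsepf
  have h12 : i₁ ≠ i₂ := fun h => h₁₁ (h ▸ h₂₁)
  have h13 : i₁ ≠ i₃ := fun h => h₁₁ (h ▸ h₃₁)
  have h23 : i₂ ≠ i₃ := fun h => h₂₂ (h ▸ h₃₂)
  -- step 2: a common zero `b ≠ 0` of the `gᵢ`, `i ∉ {i₁, i₂, i₃}`
  have hcard : ({i₁, i₂, i₃} : Finset ι).card = 3 := by
    rw [Finset.card_eq_three]
    exact ⟨i₁, i₂, i₃, h12, h13, h23, rfl⟩
  obtain ⟨b, hb, hgb⟩ := exists_ne_zero_forall_not_mem g {i₁, i₂, i₃} (by omega)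
  have hg : ∀ l, l ≠ i₁ → l ≠ i₂ → l ≠ i₃ → g l b = 0 := fun l h1 h2 h3 =>
    hgb l (by simp [h1, h2, h3])
  -- `b = 1 · b = ∑ (fᵢ(1) gᵢ(b)) Wᵢ ≠ 0`: some `j ∈ {i₁, i₂, i₃}` has `g_j(b) ≠ 0`, `W_j ≠ 0`
  obtain ⟨j, -, hj⟩ : ∃ j ∈ (Finset.univ : Finset ι), (f j 1 * g j b) • W j ≠ 0 := by
    apply Finset.exists_ne_zero_of_sum_ne_zero
    rw [← hXY, one_mul]
    exact hb
  have hgj : g j b ≠ 0 := fun h => hj (by rw [h, mul_zero, zero_smul])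
  have hjmem : j = i₁ ∨ j = i₂ ∨ j = i₃ := by
    by_contra hc
    push Not at hc
    exact hgj (hg j hc.1 hc.2.1 hc.2.2)
  rcases hjmem with h | h | h
  · exact false_of_computation_core hι f g W hXY i₁ i₂ i₃ x₁ b hb
      hg (h ▸ hgj) h₁₁ h₂₁ h₃₁
  · exact false_of_computation_core hι f g W hXY i₂ i₁ i₃ x₂ b hb
      (fun l h1 h2 h3 => hg l h2 h1 h3) (h ▸ hgj) h₂₂ h₁₂ h₃₂
  · exact false_of_computation_core hι f g W hXY i₃ i₁ i₂ x₃ b hb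
      (fun l h1 h2 h3 => hg l h2 h3 h1) (h ▸ hgj) h₃₃ h₁₃ h₂₃

/-- **Winograd 1971 / Hopcroft–Kerr 1971 / BCS Cor. (17.10), as a statement on triad
decompositions**: `⟨2,2,2⟩` is not a sum of `≤ 6` triads over a field.
[cite: BurgisserClausenShokrollahi1997, Cor. (17.10)] -/
theorem false_of_decomposition_card_le_six {ι : Type*} [Fintype ι] [DecidableEq ι]
    (hι : Fintype.card ι ≤ 6) (w u v : ι → Fin 2 × Fin 2 → K)
    (h : matMulTensor K 2 2 2 = ∑ i, triad (w i) (u i) (v i)) : False := by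
  -- the linear form `X ↦ ∑_b p(b) X_b` with coefficient pattern `p`
  let form : (Fin 2 × Fin 2 → K) → (Matrix (Fin 2) (Fin 2) K →ₗ[K] K) := fun p =>
    { toFun := fun X => ∑ b, p b * X b.1 b.2
      map_add' := fun X Y => by
        simp only [Matrix.add_apply, mul_add, Finset.sum_add_distrib]
      map_smul' := fun c X => by
        simp only [Matrix.smul_apply, smul_eq_mul, RingHom.id_apply, Finset.mul_sum]
        exact Finset.sum_congr rfl fun b _ => by ring }
  exact false_of_computation hι (fun i => form (u i)) (fun i => form (v i))
    (fun i => Matrix.of fun r s => w i (r, s)) (mul_eq_sum_of_decomposition w u v h)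

/-! ### Non-emptiness of the set of decomposition lengths -/

/-- Over finite index types every tensor is the sum of the coordinate triads
`t_{abc} e_a ⊗ e_b ⊗ e_c` (Bläser 2013, §4). [cite: Blaser2013, §4] -/
theorem eq_sum_triad_single {ι κ μ : Type*} [Fintype ι] [Fintype κ] [Fintype μ] [DecidableEq ι]
    [DecidableEq κ] [DecidableEq μ] (t : ι → κ → μ → K) :
    t = ∑ p : ι × κ × μ, triad (Pi.single p.1 (t p.1 p.2.1 p.2.2)) (Pi.single p.2.1 (1 : K))
      (Pi.single p.2.2 (1 : K)) := by
  funext a b c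
  rw [Finset.sum_apply, Finset.sum_apply, Finset.sum_apply]
  simp only [triad_apply]
  rw [Fintype.sum_eq_single (a, b, c)]
  · simp
  · rintro ⟨a', b', c'⟩ hne
    by_cases ha : a' = a
    · subst ha
      by_cases hb : b' = b
      · subst hb
        have hc : c' ≠ c := fun h => hne (by subst h; rfl)
        simp [Ne.symm hc]
      · simp [Pi.single_apply, Ne.symm hb]
    · simp [Pi.single_apply, Ne.symm ha]

/-- Over finite index types every tensor has a triad decomposition indexed by some `Fin r`, so
the infimum defining `tensorRank` is over a non-empty set (Bläser 2013, §4).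
[cite: Blaser2013, §4] -/
theorem exists_eq_sum_triad {ι κ μ : Type*} [Fintype ι] [Fintype κ] [Fintype μ]
    (t : ι → κ → μ → K) :
    ∃ (r : ℕ) (w : Fin r → ι → K) (u : Fin r → κ → K) (v : Fin r → μ → K),
      t = ∑ i, triad (w i) (u i) (v i) := by
  classical
  set e := Fintype.equivFin (ι × κ × μ)
  refine ⟨Fintype.card (ι × κ × μ),
    fun i => Pi.single (e.symm i).1 (t (e.symm i).1 (e.symm i).2.1 (e.symm i).2.2),
    fun i => Pi.single (e.symm i).2.1 1, fun i => Pi.single (e.symm i).2.2 1, ?_⟩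
  exact (eq_sum_triad_single t).trans (Fintype.sum_equiv e _ _ fun s => by simp [e])

end TwoByTwoRank

/-- **Winograd 1971, Theorem 3.1** ("Every algorithm for multiplying two `2 × 2` matrices
requires at least seven multiplications") in rank form over EVERY field: `7 ≤ R(⟨2,2,2⟩)`.
Winograd's printed proof is over `ℚ`; the all-fields statement is Bürgisser–Clausen–Shokrollahi
1997, Cor. (17.10) (Hopcroft–Kerr, Winograd), from Prop. (17.9) (`R(A) ≥ 2 dim A − 1` for a
simple algebra `A`, proof by Baur), which `TwoByTwoRank.false_of_computation` formalises for
`A = K^{2×2}`. The infimum defining `tensorRank` is attained (`TwoByTwoRank.exists_eq_sum_triad`),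
and a minimising decomposition of length `≤ 6` is impossible.
[cite: Winograd1971, Thm. 3.1; BurgisserClausenShokrollahi1997, Prop. (17.9), Cor. (17.10)] -/
theorem seven_le_tensorRank_matMulTensor_two (K : Type*) [Field K] :
    7 ≤ tensorRank (matMulTensor K 2 2 2) := by
  obtain ⟨r₀, w₀, u₀, v₀, h₀⟩ := TwoByTwoRank.exists_eq_sum_triad (matMulTensor K 2 2 2)
  unfold tensorRank
  refine le_csInf ?_ ?_
  · exact ⟨r₀, w₀, u₀, v₀, h₀⟩
  rintro r ⟨w, u, v, h⟩
  by_contra hlt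
  push Not at hlt
  exact TwoByTwoRank.false_of_decomposition_card_le_six (ι := Fin r)
    (by rw [Fintype.card_fin]; omega) w u v h


end Literature.Computability.AlgebraicComplexity
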